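import Summits.BirchSwinnertonDyer.BirchSwinnertonDyer.Theorems.KimAtThreeDeepUpperTowerLattice
import Summits.BirchSwinnertonDyer.BirchSwinnertonDyer.Theorems.EdixhovenFibreFiveSevenReceptacleBaseChangeSocket
import Summits.BirchSwinnertonDyer.BirchSwinnertonDyer.Theorems.AdditiveKolyvaginRoadManinFrameResidueProperRSemiLocalDescent
import HarnessLib

/-!
# F″ programme, piece P4-coh: the DEFINED semi-local `exp*` of Kato's classes is `w`-INTEGRAL at every `w ∣ p`
# of `ℚ(ζ_m)`, `p ∤ m`, under F″'s clause — NO LOSS (route `EdixhovenFibreFiveSeven`, crux K★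
# stmt-BirchSwinnertonDyer-22226, line `kato-lever`; seat `bsd-line-edix-p3` g4; `--supports 22226`, helper)

HONEST FRAMING. TOOL theorems only (no definition, no named fact, no `sorry`); nothing is closed or booked; BSD is
not proved by any of this. CONDITIONAL on ONE cite-only Literature fact, DISPLAYED as a hypothesis: (S5b-tower)
`PAdicHodge.exists_smul_range_expStarCoord_tower_iff_trace_log` (Kato LNM 1553 II Thm. 1.4.1 (3)–(4) + Bloch–Kato
Prop. 3.8 / Ex. 3.11 at two levels of a tower for ONE differential).

WHERE THIS SITS. F″ = `Literature.NumberTheory.EllipticCurves.kato_neron_isIntegral_twistedSymbolSum_of_additive_five_le`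
is the ONE open stub of K★'s registered skeleton (`Cruxes/StarredOptimalManinUnitFiveSeven/Lines/kato_lever.lean`),
and binds TDS57 22227 / KP57 23810 / AKR #7 20709 as well. The F″ programme (map `…/Lines/kato-lever-F2-programme.md`
§4, roadmap `Cruxes/ManinFrameResidueProper/P4-ROADMAP-manin-p1-g8.md` §2) reads F″ off a Néron-pinned Kato value law
(P1, cite) through: P6 isogeny transport (p597552) ∘ value exit (p598918, p599800) ∘ units (p599331, p599628,
p599933) ∘ P4-core semi-local DESCENT (p598912,
`SemiLocalDescent.exists_not_dvd_isIntegral_charSum_of_forall_semilocal_mem`, whose ONE displayed input is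
`hint : ∀ w ∣ p, Ψ (Λ z) w ∈ 𝒪_w`) ∘ **P4-coh (THIS FILE: produces `hint`)** ∘ receptacle (p596837, p598030,
p599280, p600212). Chain of THIS FILE, every arrow an existing `p`-generic tree theorem:

1. (S5b-tower) instantiated in class currency at a cyclotomic completion `L_{w₀}`, `L = ℚ(ζ_m)`
   (`KimAtThreeDeepUpperExpStarTowerRange.exists_smul_ranges_of_facts`): ONE `e ∈ ℚ_vˣ` with `hdual(e • d)` at the
   base and `range(exp*_{e•dw}) = {a : ∀ P′ ∈ E(L_{w₀}), ‖Tr_{L_{w₀}/ℚ_p}(a · log_ω P′)‖ ≤ 1}` — here with the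
   compatible valuation `ν :=` the base-`p` norm of kport's synonym `K_{w₀} = KPort.Kw p L w₀` (§1
   `compatible_normValuation_Kw`), so that step 3 is edix-p2's exit BY `exact`.
2. the UNIT STEP (`KimAtThreeDeepUpperExpStarUnit.mem_integers_of_hdual_smul`): `hdual(d) ∧ hdual(e • d) ⇒ e ∈ 𝒪_v`.
3. the RECEPTACLE EXIT at `K_{w₀}` under F″'s clause AS TYPED
   (`ReceptacleTorsion.norm_le_one_of_forall_point_baseChange_Kw_of_katoClause`, p600212: `W/ℚ` globally minimal,
   `5 ≤ p`, `Addv W p`, `p ∤ m`, `7 < p ∨ (gcd(ord_m p, p − 1) = 1 ∧ E(ℚ_p)[p] = 0)`): every `a` in the trace-dual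
   set has `‖a‖ ≤ 1`, i.e. `a ∈ 𝒪_{w₀}`; the two `ℚ_[p]`-structures of `L_{w₀}` (the canonical
   `LocalField.adicCompletionPadicAlgebra` of the Kato facts, kport's on `K_{w₀}`) have the same trace
   (`Kw.trace_adicCompletionPadicAlgebra_eq`, `Kw.trace_eq`).
4. the scale law `exp*_{dw} = e · exp*_{e•dw}` (`expStarOmega_smul`) with `e ∈ 𝒪_v ↦ 𝒪_{w₀}`.
5. the (DEF) clause of a `DefinedExpStarBody`-shaped P1 reads the `w`-component `Ψ (Λ z) w` at ONE place `w₀`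
   through a Galois transport `(g̃_w⁻¹)_*`, which preserves integers
   (`SemiLocalDescent.mem_adicCompletionIntegers_of_eq_galAdicCompletionMap`, p598912) — §3.

* §1 `compatible_normValuation_Kw` — the base-`p` norm valuation of `K_w`, read on `L_w`, is compatible with the
  valuative relation of `L_w` (kport proved this for the ramified synonym `Kwe`; same proof).
* §2 ★★ `expStarOmegaHom_mem_adicCompletionIntegers_of_katoClause` — **for `W/ℚ` globally minimal, `5 ≤ p`,
  `Addv W p`, an `hdual`-normalised local Néron line `d` at `v_p` (Prop-1.2.3 binders), ANY level `m` with `p ∤ m`,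
  F″'s clause, ANY place `w₀ ∣ p` of `ℚ(ζ_m)` and ANY (RES_w)-compatible line datum `dw` of the tower representation
  at `L_{w₀}`: `exp*_{dw}(z) ∈ 𝒪_{w₀}` for EVERY class `z ∈ H¹(L_{w₀}, T_pW)`** (no `p³` loss — compare
  `KimAtThreeDeepUpperTowerLattice.pow_three_mul_expStarOmegaHom_mem_of_facts`, valid at every ramification but
  lossy; the receptacle at an UNRAMIFIED `w₀` under F″'s clause is what removes the loss).
* §3 ★ `semilocal_mem_adicCompletionIntegers_of_def` — the `hint` binder of P4-core: if the `w`-component of a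
  semi-local value is `(g̃_w⁻¹)_* (exp*_{dw} z)` for SOME class `z` at `w₀` (the (DEF) clause of
  `Kato2004.DefinedExpStarBody` / of P1, read on classes), it lies in `𝒪_w`.

NOT here: P1 (the typer's), the unpacking of a typed P1's (RES)/(DEF) into `dw`/`hres`/the (DEF) equation (one
`obtain` per clause, as in `KimAtThreeDeepLowerKatoLit.katoExact_of_lit` at `p = 3`), the Prop-1.2.3 binders
`hinjw`/`hexw` at `L_{w₀}` (cite facts `cupLogInjective_and_hasDualExp_of_isDeRham`, `isDeRham_restrictedRationalTateRep`,
instantiated there), the pin `hdual(d)` (P1's (S5)).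

References: [Kato1993LNM1553] K. Kato, LNM 1553 (1993), Ch. II §1.2.4, Thm. 1.4.1 (3)–(4); [BlochKato1990] S. Bloch,
K. Kato (1990) §3 Prop. 3.8, Ex. 3.11; [KimNakamura2020] C.-H. Kim, K. Nakamura, JNT 210 (2020) Cor. 2.4;
[KostersPannekoek2017] Thm. 1; [CasselsFrohlichANT1967] Ch. II §10 (10.2), Ch. VII §1.1; [SerreLocalFields1979]
Ch. II §1–§5; [Kato2004Asterisque] K. Kato, Astérisque 295 (2004) (8.1.3), §9.4, Thm. 9.7 (the consumer F″).
-/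

set_option autoImplicit false
-- the Theorems namespace of a single-conjunct summit repeats the summit name by design (D-0017)
set_option linter.dupNamespace false

noncomputable section

open scoped NumberField NNReal Classical
open Field ValuativeRel IsDedekindDomain NumberField
open Literature.NumberTheory.GaloisRepresentations
open Literature.NumberTheory.GaloisRepresentations.PeriodRingData
open Literature.NumberTheory.PAdicHodge
open Literature.NumberTheory.EllipticCurves WeierstrassCurve
open Literature.NumberTheory.EllipticCurves.FormalGroupChart (padicLogPointFiniteExt)
open Literature.NumberTheory.AdelicBaseChange Literature.NumberTheory.Automorphic
open Summit.BirchSwinnertonDyer.BirchSwinnertonDyer.Theorems.KimAtThreeDeepLowerExpStarOmega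
open Summit.BirchSwinnertonDyer.BirchSwinnertonDyer.Theorems.KimAtThreeDeepLowerExpStarOmegaPlace
open Summit.BirchSwinnertonDyer.BirchSwinnertonDyer.Theorems.KimAtThreeDeepUpperExpStarTowerRange
open Summit.BirchSwinnertonDyer.BirchSwinnertonDyer.Theorems.KimAtThreeDeepUpperExpStarUnit
open Summit.BirchSwinnertonDyer.BirchSwinnertonDyer.Theorems.KimAtThreeDeepUpperTowerLattice
  (fact_natCast_mem_primesEquiv_symm)
open Summit.BirchSwinnertonDyer.BirchSwinnertonDyer.Theorems.KPort
open Literature.NumberTheory.GaloisRepresentations.LubinTate (unitBall mem_unitBall_iff)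
open Summit.BirchSwinnertonDyer.BirchSwinnertonDyer.Theorems.ReceptacleTorsion
  (norm_le_one_of_forall_point_baseChange_Kw_of_katoClause)
open Summit.BirchSwinnertonDyer.BirchSwinnertonDyer.Theorems.SemiLocalDescent
  (mem_adicCompletionIntegers_of_eq_galAdicCompletionMap)
open Summit.BirchSwinnertonDyer.Rank1Residual.GaloisImage
open Summit.BirchSwinnertonDyer.Rank1Residual.Additive.LocalLog (padicLog)
open Rat.HeightOneSpectrum

namespace Summit.BirchSwinnertonDyer.BirchSwinnertonDyer.Theorems.SemiLocalIntegrality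

/-! ## §1 The base-`p` norm valuation of `K_w`, read on `L_w`, is compatible -/

section Compatible

variable {p : ℕ} [hp : Fact p.Prime] {L : Type} [Field L] [NumberField L]
  {w : ((primesEquiv (R := 𝓞 ℚ)).symm ⟨p, hp.out⟩).Extension (𝓞 L)}

/-- **The base-`p` norm valuation `‖·‖₊` of kport's synonym `K_w = KPort.Kw p L w`, read on `L_w` along the identity
`Kw.toCompletion`, is compatible with the valuative relation of `L_w`** — so it inhabits the `[ν.Compatible]` binder of
(S5b)/(S5b-tower) (both are equivalent to `Valued.v`; kport's `Kw.valuation_isEquiv_valued`). [cite: SerreLocalFields1979, Ch. II §1] -/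
theorem compatible_normValuation_Kw :
    ((NormedField.valuation : Valuation (Kw p L w) ℝ≥0).comap (Kw.toCompletion p L w).symm.toRingHom).Compatible := by
  refine ⟨fun x y => ?_⟩
  have hV := (Valuation.Compatible.vle_iff_le (v := (Valued.v : Valuation (w.1.adicCompletion L)
    (WithZero (Multiplicative ℤ)))) x y)
  rw [hV]
  exact (Kw.valuation_isEquiv_valued (p := p) (L := L) (w := w) ((Kw.toCompletion p L w).symm x)
    ((Kw.toCompletion p L w).symm y)).symm

end Compatible

/-! ## §2 `exp*_{dw}(H¹(L_{w₀}, T_pW)) ⊆ 𝒪_{w₀}` at an unramified cyclotomic completion under F″'s clause -/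

variable (p : ℕ) [hp : Fact p.Prime]

-- FILE-LOCAL instance keys, byte-identical to the accepted `KimAtThreeDeepUpperTowerLattice.lean` l.92–98 /
-- `KimAtThreeDeepUpperExpStarFacts.lean` l.76–79 (no library instance is overridden outside this file): the `Fact (p ∈ v_p)`
-- key and the local-field structures on `ℚ_v = Place.Completion (inr v_p)` under which the W2 cell's `exp*_ω` API is stated.
attribute [local instance] fact_natCast_mem_primesEquiv_symm
-- the tree's `ℚ`-algebra structure on `ℚ_v` first (see `KimAtThreeDeepUpperExpStarFacts`)
attribute [local instance 100000] NumberField.Place.instAlgebraCompletion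
attribute [local instance] valuativeRelPlace topologicalSpacePlace
attribute [local instance] isNonarchimedeanLocalField_place charZero_place
attribute [local instance] padicAlgebraPlace fact_not_isUnit_place isAdicComplete_place

set_option backward.isDefEq.respectTransparency false in
set_option maxHeartbeats 800000 in
/-- ★★ **P4-coh: the defined `exp*` of the tower representation is INTEGRAL at an unramified cyclotomic completion,
under F″'s clause.** For `W/ℚ` globally minimal with `5 ≤ p` additive (`Addv W p`), a local Néron line `d` at `v_p`
with Prop-1.2.3 binders and `hdual` (read in `ℚ_p` through `e_p⁻¹`), a level `m` with `p ∤ m`, F″'s clause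
`7 < p ∨ (Nat.Coprime (orderOf (p : ZMod m)) (p − 1) ∧ ∀ P : E(ℚ_p), p • P = 0 → P = 0)`, a place `w₀ ∣ p` of
`ℚ(ζ_m)` and a line datum `dw` of the tower representation at `L_{w₀}` with Prop-1.2.3 binders and (RES_w)
`exp*_{dw} ∘ res = (ℚ_v → L_{w₀}) ∘ exp*_d`: **`exp*_{dw}(z) ∈ 𝒪_{w₀}` for every `z ∈ H¹(L_{w₀}, T_pW)`.**
Chain: (S5b-tower) gives ONE `e` with `range(exp*_{e•dw}) = (log_ω E(L_{w₀}))^∨` and `hdual(e•d)`; the unit step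
gives `e ∈ 𝒪_v`; the receptacle exit at `K_{w₀}` (Kim–Nakamura Cor. 2.4 as a theorem, edix-p2 p600212) gives
`(log_ω E(L_{w₀}))^∨ ⊆ 𝒪_{w₀}`; finally `exp*_{dw} = e · exp*_{e•dw}`. CONDITIONAL on the cite fact (S5b-tower) only.
[cite: Kato1993LNM1553, Ch. II §1.2.4, Thm. 1.4.1 (3)–(4)] [cite: BlochKato1990, §3 Prop. 3.8, Ex. 3.11]
[cite: KimNakamura2020, Cor. 2.4] [cite: CasselsFrohlichANT1967, Ch. II §10 Theorem (10.2)] -/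
theorem expStarOmegaHom_mem_adicCompletionIntegers_of_katoClause
    (hT₂ : exists_smul_range_expStarCoord_tower_iff_trace_log)
    (W : WeierstrassCurve ℚ) [W.IsElliptic] [W.IsGloballyMinimal] (hp5 : 5 ≤ p)
    (hadd : Literature.NumberTheory.EllipticCurves.Rank1Residual.Addv W p)
    (d : LocalNeronLineAt W p ((primesEquiv (R := 𝓞 ℚ)).symm ⟨p, hp.out⟩))
    (hinj : (bdRPeriodRingData (valuation_place_lt_one p ((primesEquiv (R := 𝓞 ℚ)).symm ⟨p, hp.out⟩))).CupLogInjective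
      (logCyclotomic p) (localRationalTateRep W p (galRestrictPlace ((primesEquiv (R := 𝓞 ℚ)).symm ⟨p, hp.out⟩))))
    (hex : ∀ z : contOneCocycles (localRationalTateRep W p (galRestrictPlace ((primesEquiv (R := 𝓞 ℚ)).symm ⟨p, hp.out⟩))).toTopRep,
      (bdRPeriodRingData (valuation_place_lt_one p ((primesEquiv (R := 𝓞 ℚ)).symm ⟨p, hp.out⟩))).HasDualExp (logCyclotomic p)
        (localRationalTateRep W p (galRestrictPlace ((primesEquiv (R := 𝓞 ℚ)).symm ⟨p, hp.out⟩))) fun σ => z.1 σ)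
    (hdual : ∀ a : ℚ_[p], (∃ y, expStarOmegaPadicAt d hinj hex
        (((Padic.adicCompletionEquiv (𝓞 ℚ) ⟨p, hp.out⟩).symm : (((primesEquiv (R := 𝓞 ℚ)).symm ⟨p, hp.out⟩).adicCompletion ℚ) →+* ℚ_[p])) y = a) ↔
      ∀ Q : (W.baseChange ℚ_[p]).toAffine.Point, ‖a * padicLog (W.baseChange ℚ_[p]) Q‖ ≤ 1)
    (m : ℕ) [NeZero m] (hpm : ¬ p ∣ m)
    (hcl : 7 < p ∨ (Nat.Coprime (orderOf (p : ZMod m)) (p - 1) ∧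
      ∀ P : (W.baseChange ℚ_[p]).toAffine.Point, p • P = 0 → P = 0))
    (w₀ : ((primesEquiv (R := 𝓞 ℚ)).symm ⟨p, hp.out⟩).Extension (𝓞 (CyclotomicField m ℚ))) :
    letI := LocalField.charZero_adicCompletion w₀.1
    letI := LocalField.adicCompletionPadicAlgebra w₀.1 p (Kw.prime_mem_asIdeal w₀)
    haveI : Fact (¬ IsUnit ((p : ℕ) : integerC (w₀.1.adicCompletion (CyclotomicField m ℚ)))) := ⟨not_isUnit_natCast_integerC (LocalField.valuation_adicCompletion_natCast_lt_one w₀.1 p (Kw.prime_mem_asIdeal w₀))⟩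
    haveI := isAdicComplete_integerC_natCast (LocalField.valuation_adicCompletion_natCast_lt_one w₀.1 p (Kw.prime_mem_asIdeal w₀))
    ∀ (dw : LocalNeronLine W (LocalField.valuation_adicCompletion_natCast_lt_one w₀.1 p (Kw.prime_mem_asIdeal w₀)) ((galRestrictPlace ((primesEquiv (R := 𝓞 ℚ)).symm ⟨p, hp.out⟩)).comp (absGaloisRestrict (((primesEquiv (R := 𝓞 ℚ)).symm ⟨p, hp.out⟩).adicCompletion ℚ) (w₀.1.adicCompletion (CyclotomicField m ℚ)))))
      (hinjw : (bdRPeriodRingData (LocalField.valuation_adicCompletion_natCast_lt_one w₀.1 p (Kw.prime_mem_asIdeal w₀))).CupLogInjective (logCyclotomic p) (localRationalTateRep W p ((galRestrictPlace ((primesEquiv (R := 𝓞 ℚ)).symm ⟨p, hp.out⟩)).comp (absGaloisRestrict (((primesEquiv (R := 𝓞 ℚ)).symm ⟨p, hp.out⟩).adicCompletion ℚ) (w₀.1.adicCompletion (CyclotomicField m ℚ))))))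
      (hexw : ∀ z : contOneCocycles (localRationalTateRep W p ((galRestrictPlace ((primesEquiv (R := 𝓞 ℚ)).symm ⟨p, hp.out⟩)).comp (absGaloisRestrict (((primesEquiv (R := 𝓞 ℚ)).symm ⟨p, hp.out⟩).adicCompletion ℚ) (w₀.1.adicCompletion (CyclotomicField m ℚ))))).toTopRep,
        (bdRPeriodRingData (LocalField.valuation_adicCompletion_natCast_lt_one w₀.1 p (Kw.prime_mem_asIdeal w₀))).HasDualExp (logCyclotomic p) (localRationalTateRep W p ((galRestrictPlace ((primesEquiv (R := 𝓞 ℚ)).symm ⟨p, hp.out⟩)).comp (absGaloisRestrict (((primesEquiv (R := 𝓞 ℚ)).symm ⟨p, hp.out⟩).adicCompletion ℚ) (w₀.1.adicCompletion (CyclotomicField m ℚ))))) fun σ => z.1 σ),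
      (∀ h : (tateLocalRep W p (Sum.inr ((primesEquiv (R := 𝓞 ℚ)).symm ⟨p, hp.out⟩))).cohomology 1,
        expStarOmegaHom (LocalField.valuation_adicCompletion_natCast_lt_one w₀.1 p (Kw.prime_mem_asIdeal w₀)) ((galRestrictPlace ((primesEquiv (R := 𝓞 ℚ)).symm ⟨p, hp.out⟩)).comp (absGaloisRestrict (((primesEquiv (R := 𝓞 ℚ)).symm ⟨p, hp.out⟩).adicCompletion ℚ) (w₀.1.adicCompletion (CyclotomicField m ℚ)))) dw hinjw hexw
          (ContinuousRep.cohomologyRes (tateLocalRep W p (Sum.inr ((primesEquiv (R := 𝓞 ℚ)).symm ⟨p, hp.out⟩))) (absGaloisRestrict (((primesEquiv (R := 𝓞 ℚ)).symm ⟨p, hp.out⟩).adicCompletion ℚ) (w₀.1.adicCompletion (CyclotomicField m ℚ))) 1 h) =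
        algebraMap (((primesEquiv (R := 𝓞 ℚ)).symm ⟨p, hp.out⟩).adicCompletion ℚ) (w₀.1.adicCompletion (CyclotomicField m ℚ)) (expStarOmegaAt d h)) →
      ∀ z, expStarOmegaHom (LocalField.valuation_adicCompletion_natCast_lt_one w₀.1 p (Kw.prime_mem_asIdeal w₀)) ((galRestrictPlace ((primesEquiv (R := 𝓞 ℚ)).symm ⟨p, hp.out⟩)).comp (absGaloisRestrict (((primesEquiv (R := 𝓞 ℚ)).symm ⟨p, hp.out⟩).adicCompletion ℚ) (w₀.1.adicCompletion (CyclotomicField m ℚ)))) dw hinjw hexw z ∈ (w₀.1.adicCompletionIntegers (CyclotomicField m ℚ)) := by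
  intro dw hinjw hexw hres z
  letI := LocalField.charZero_adicCompletion w₀.1
  letI := LocalField.adicCompletionPadicAlgebra w₀.1 p (Kw.prime_mem_asIdeal w₀)
  haveI : Fact (¬ IsUnit ((p : ℕ) : integerC (w₀.1.adicCompletion (CyclotomicField m ℚ)))) := ⟨not_isUnit_natCast_integerC (LocalField.valuation_adicCompletion_natCast_lt_one w₀.1 p (Kw.prime_mem_asIdeal w₀))⟩
  haveI := isAdicComplete_integerC_natCast (LocalField.valuation_adicCompletion_natCast_lt_one w₀.1 p (Kw.prime_mem_asIdeal w₀))
  -- `Place.Completion (inr v₀)` is `ℚ_{v₀}` by `rfl`: read the packet's algebra structure on it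
  letI instEF : Algebra (NumberField.Place.Completion (K := ℚ) (Sum.inr ((primesEquiv (R := 𝓞 ℚ)).symm ⟨p, hp.out⟩))) (w₀.1.adicCompletion (CyclotomicField m ℚ)) :=
    inferInstanceAs (Algebra (((primesEquiv (R := 𝓞 ℚ)).symm ⟨p, hp.out⟩).adicCompletion ℚ) (w₀.1.adicCompletion (CyclotomicField m ℚ)))
  -- the compatible `ℝ≥0`-valuation on `L_{w₀}`: the base-`p` norm of the synonym `K_{w₀}` (unramified), and integrality
  haveI hνc := compatible_normValuation_Kw (p := p) (L := (CyclotomicField m ℚ)) (w := w₀)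
  haveI : (W.baseChange (w₀.1.adicCompletion (CyclotomicField m ℚ))).IsIntegral
      ((NormedField.valuation : Valuation (Kw p (CyclotomicField m ℚ) w₀) ℝ≥0).comap
        (Kw.toCompletion p (CyclotomicField m ℚ) w₀).symm.toRingHom).integer :=
    Kw.isIntegral_baseChange_of_isGloballyMinimal _ W
  -- (S5b-tower): ONE rescaling `e`
  obtain ⟨e, he, hde, hrange⟩ := exists_smul_ranges_of_facts W p ((primesEquiv (R := 𝓞 ℚ)).symm ⟨p, hp.out⟩) (LocalField.valuation_adicCompletion_natCast_lt_one w₀.1 p (Kw.prime_mem_asIdeal w₀)) hT₂ d hinj hex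
    ((NormedField.valuation : Valuation (Kw p (CyclotomicField m ℚ) w₀) ℝ≥0).comap (Kw.toCompletion p (CyclotomicField m ℚ) w₀).symm.toRingHom)
    dw hinjw hexw hres (((Padic.adicCompletionEquiv (𝓞 ℚ) ⟨p, hp.out⟩).symm : (((primesEquiv (R := 𝓞 ℚ)).symm ⟨p, hp.out⟩).adicCompletion ℚ) →+* ℚ_[p]))
  -- the unit step: `e ∈ 𝒪_v`
  obtain ⟨heO, -⟩ := mem_integers_of_hdual_smul W p ((primesEquiv (R := 𝓞 ℚ)).symm ⟨p, hp.out⟩) d hinj hex _ hdual he hde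
  have hE0 : algebraMap (((primesEquiv (R := 𝓞 ℚ)).symm ⟨p, hp.out⟩).adicCompletion ℚ) (w₀.1.adicCompletion (CyclotomicField m ℚ)) e ≠ 0 := (map_ne_zero _).mpr he
  have hEO : algebraMap (((primesEquiv (R := 𝓞 ℚ)).symm ⟨p, hp.out⟩).adicCompletion ℚ) (w₀.1.adicCompletion (CyclotomicField m ℚ)) e ∈ (w₀.1.adicCompletionIntegers (CyclotomicField m ℚ)) :=
    w₀.adicCompletionSemialgHom_image_adicCompletionIntegers ℚ (CyclotomicField m ℚ) ⟨e, heO, rfl⟩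
  -- `exp*_{dw} z = E · a'` with `a' := exp*_{E•dw} z` in the trace dual of `log_ω E(L_{w₀})`
  set a' := expStarOmegaHom (LocalField.valuation_adicCompletion_natCast_lt_one w₀.1 p (Kw.prime_mem_asIdeal w₀)) ((galRestrictPlace ((primesEquiv (R := 𝓞 ℚ)).symm ⟨p, hp.out⟩)).comp (absGaloisRestrict (((primesEquiv (R := 𝓞 ℚ)).symm ⟨p, hp.out⟩).adicCompletion ℚ) (w₀.1.adicCompletion (CyclotomicField m ℚ)))) (dw.smul (algebraMap (((primesEquiv (R := 𝓞 ℚ)).symm ⟨p, hp.out⟩).adicCompletion ℚ) (w₀.1.adicCompletion (CyclotomicField m ℚ)) e) ((map_ne_zero (algebraMap (((primesEquiv (R := 𝓞 ℚ)).symm ⟨p, hp.out⟩).adicCompletion ℚ) (w₀.1.adicCompletion (CyclotomicField m ℚ)))).mpr he))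
        hinjw hexw z with ha'_def
  have haa' : expStarOmegaHom (LocalField.valuation_adicCompletion_natCast_lt_one w₀.1 p (Kw.prime_mem_asIdeal w₀)) ((galRestrictPlace ((primesEquiv (R := 𝓞 ℚ)).symm ⟨p, hp.out⟩)).comp (absGaloisRestrict (((primesEquiv (R := 𝓞 ℚ)).symm ⟨p, hp.out⟩).adicCompletion ℚ) (w₀.1.adicCompletion (CyclotomicField m ℚ)))) dw hinjw hexw z = algebraMap (((primesEquiv (R := 𝓞 ℚ)).symm ⟨p, hp.out⟩).adicCompletion ℚ) (w₀.1.adicCompletion (CyclotomicField m ℚ)) e * a' := by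
    rw [ha'_def, expStarOmegaHom_apply, expStarOmegaHom_apply, expStarOmega_smul, ← mul_assoc, mul_inv_cancel₀ hE0, one_mul]
  have hdual' := (hrange a').mp ⟨z, ha'_def.symm⟩
  -- the receptacle exit at `K_{w₀}` (unramified: `p ∤ m`), in (S5b)'s literal currency
  haveI : Fact (w₀.1.asIdeal.ramificationIdx (𝓞 ℚ) = 1) :=
    ⟨Kw.ramificationIdx_eq_one_of_isCyclotomicExtension (p := p) (L := CyclotomicField m ℚ) (w := w₀) m hpm⟩
  letI instQKw : Algebra ℚ (Kw p (CyclotomicField m ℚ) w₀) :=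
    inferInstanceAs (Algebra ℚ (w₀.1.adicCompletion (CyclotomicField m ℚ)))
  haveI : (W.baseChange (Kw p (CyclotomicField m ℚ) w₀)).IsIntegral
      (NormedField.valuation (K := Kw p (CyclotomicField m ℚ) w₀)).integer :=
    Kw.isIntegral_baseChange_of_isGloballyMinimal _ W
  have ha'1 : ‖(Kw.toCompletion p (CyclotomicField m ℚ) w₀).symm a'‖ ≤ 1 := by
    refine norm_le_one_of_forall_point_baseChange_Kw_of_katoClause p (CyclotomicField m ℚ) w₀ W m hpm hp5 hadd hcl
      fun P => ?_
    have h1 := hdual' P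
    rw [Kw.trace_adicCompletionPadicAlgebra_eq w₀ (Kw.prime_mem_asIdeal w₀)] at h1
    rw [Kw.trace_eq]
    exact h1
  have ha'O : a' ∈ w₀.1.adicCompletionIntegers (CyclotomicField m ℚ) :=
    (Kw.mem_unitBall_iff_mem_adicCompletionIntegers _).mp ((mem_unitBall_iff _).mpr ha'1)
  rw [haa']
  exact mul_mem hEO ha'O

/-! ## §3 The `hint` binder of P4-core: every `w`-component read at `w₀` through a Galois transport is integral -/

set_option backward.isDefEq.respectTransparency false in
set_option maxHeartbeats 800000 in
/-- ★ **P4-coh, semi-local form (the `hint` binder of P4-core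
`SemiLocalDescent.exists_not_dvd_isIntegral_charSum_of_forall_semilocal_mem`).** Under the hypotheses of
`expStarOmegaHom_mem_adicCompletionIntegers_of_katoClause` at a place `w₀ ∣ p` of `L = ℚ(ζ_m)`, `p ∤ m`: if a
semi-local vector `t ∈ ∏_{w ∣ p} L_w` has, at every `w`, the shape `t_w = (σ_w⁻¹)_* (exp*_{dw} z_w)` for a Galois
transport `σ_w : L ≃ L` with `σ_w • w = w₀` and SOME class `z_w ∈ H¹(L_{w₀}, T_pW)` — the (DEF) clause of
`Kato2004.DefinedExpStarBody` / of a Néron-pinned P1 read on classes, with `σ_w = sigma m (χ_m (g w))` and `z_w` the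
tower localisation of `g_w · y` — then **`t_w ∈ 𝒪_w` for every `w ∣ p`** (transports preserve integers,
`SemiLocalDescent.mem_adicCompletionIntegers_of_eq_galAdicCompletionMap`). With `t := Ψ (Λ y)` this is `hint`.
[cite: Kato1993LNM1553, Ch. II §1.2.4, Thm. 1.4.1 (3)–(4)] [cite: BlochKato1990, §3 Prop. 3.8, Ex. 3.11]
[cite: KimNakamura2020, Cor. 2.4] [cite: CasselsFrohlichANT1967, Ch. II §10 Theorem (10.2), Ch. VII §1.1] -/
theorem semilocal_mem_adicCompletionIntegers_of_def
    (hT₂ : exists_smul_range_expStarCoord_tower_iff_trace_log)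
    (W : WeierstrassCurve ℚ) [W.IsElliptic] [W.IsGloballyMinimal] (hp5 : 5 ≤ p)
    (hadd : Literature.NumberTheory.EllipticCurves.Rank1Residual.Addv W p)
    (d : LocalNeronLineAt W p ((primesEquiv (R := 𝓞 ℚ)).symm ⟨p, hp.out⟩))
    (hinj : (bdRPeriodRingData (valuation_place_lt_one p ((primesEquiv (R := 𝓞 ℚ)).symm ⟨p, hp.out⟩))).CupLogInjective
      (logCyclotomic p) (localRationalTateRep W p (galRestrictPlace ((primesEquiv (R := 𝓞 ℚ)).symm ⟨p, hp.out⟩))))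
    (hex : ∀ z : contOneCocycles (localRationalTateRep W p (galRestrictPlace ((primesEquiv (R := 𝓞 ℚ)).symm ⟨p, hp.out⟩))).toTopRep,
      (bdRPeriodRingData (valuation_place_lt_one p ((primesEquiv (R := 𝓞 ℚ)).symm ⟨p, hp.out⟩))).HasDualExp (logCyclotomic p)
        (localRationalTateRep W p (galRestrictPlace ((primesEquiv (R := 𝓞 ℚ)).symm ⟨p, hp.out⟩))) fun σ => z.1 σ)
    (hdual : ∀ a : ℚ_[p], (∃ y, expStarOmegaPadicAt d hinj hex
        (((Padic.adicCompletionEquiv (𝓞 ℚ) ⟨p, hp.out⟩).symm : (((primesEquiv (R := 𝓞 ℚ)).symm ⟨p, hp.out⟩).adicCompletion ℚ) →+* ℚ_[p])) y = a) ↔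
      ∀ Q : (W.baseChange ℚ_[p]).toAffine.Point, ‖a * padicLog (W.baseChange ℚ_[p]) Q‖ ≤ 1)
    (m : ℕ) [NeZero m] (hpm : ¬ p ∣ m)
    (hcl : 7 < p ∨ (Nat.Coprime (orderOf (p : ZMod m)) (p - 1) ∧
      ∀ P : (W.baseChange ℚ_[p]).toAffine.Point, p • P = 0 → P = 0))
    (w₀ : ((primesEquiv (R := 𝓞 ℚ)).symm ⟨p, hp.out⟩).Extension (𝓞 (CyclotomicField m ℚ))) :
    letI := LocalField.charZero_adicCompletion w₀.1
    letI := LocalField.adicCompletionPadicAlgebra w₀.1 p (Kw.prime_mem_asIdeal w₀)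
    haveI : Fact (¬ IsUnit ((p : ℕ) : integerC (w₀.1.adicCompletion (CyclotomicField m ℚ)))) := ⟨not_isUnit_natCast_integerC (LocalField.valuation_adicCompletion_natCast_lt_one w₀.1 p (Kw.prime_mem_asIdeal w₀))⟩
    haveI := isAdicComplete_integerC_natCast (LocalField.valuation_adicCompletion_natCast_lt_one w₀.1 p (Kw.prime_mem_asIdeal w₀))
    ∀ (dw : LocalNeronLine W (LocalField.valuation_adicCompletion_natCast_lt_one w₀.1 p (Kw.prime_mem_asIdeal w₀)) ((galRestrictPlace ((primesEquiv (R := 𝓞 ℚ)).symm ⟨p, hp.out⟩)).comp (absGaloisRestrict (((primesEquiv (R := 𝓞 ℚ)).symm ⟨p, hp.out⟩).adicCompletion ℚ) (w₀.1.adicCompletion (CyclotomicField m ℚ)))))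
      (hinjw : (bdRPeriodRingData (LocalField.valuation_adicCompletion_natCast_lt_one w₀.1 p (Kw.prime_mem_asIdeal w₀))).CupLogInjective (logCyclotomic p) (localRationalTateRep W p ((galRestrictPlace ((primesEquiv (R := 𝓞 ℚ)).symm ⟨p, hp.out⟩)).comp (absGaloisRestrict (((primesEquiv (R := 𝓞 ℚ)).symm ⟨p, hp.out⟩).adicCompletion ℚ) (w₀.1.adicCompletion (CyclotomicField m ℚ))))))
      (hexw : ∀ z : contOneCocycles (localRationalTateRep W p ((galRestrictPlace ((primesEquiv (R := 𝓞 ℚ)).symm ⟨p, hp.out⟩)).comp (absGaloisRestrict (((primesEquiv (R := 𝓞 ℚ)).symm ⟨p, hp.out⟩).adicCompletion ℚ) (w₀.1.adicCompletion (CyclotomicField m ℚ))))).toTopRep,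
        (bdRPeriodRingData (LocalField.valuation_adicCompletion_natCast_lt_one w₀.1 p (Kw.prime_mem_asIdeal w₀))).HasDualExp (logCyclotomic p) (localRationalTateRep W p ((galRestrictPlace ((primesEquiv (R := 𝓞 ℚ)).symm ⟨p, hp.out⟩)).comp (absGaloisRestrict (((primesEquiv (R := 𝓞 ℚ)).symm ⟨p, hp.out⟩).adicCompletion ℚ) (w₀.1.adicCompletion (CyclotomicField m ℚ))))) fun σ => z.1 σ),
      (∀ h : (tateLocalRep W p (Sum.inr ((primesEquiv (R := 𝓞 ℚ)).symm ⟨p, hp.out⟩))).cohomology 1,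
        expStarOmegaHom (LocalField.valuation_adicCompletion_natCast_lt_one w₀.1 p (Kw.prime_mem_asIdeal w₀)) ((galRestrictPlace ((primesEquiv (R := 𝓞 ℚ)).symm ⟨p, hp.out⟩)).comp (absGaloisRestrict (((primesEquiv (R := 𝓞 ℚ)).symm ⟨p, hp.out⟩).adicCompletion ℚ) (w₀.1.adicCompletion (CyclotomicField m ℚ)))) dw hinjw hexw
          (ContinuousRep.cohomologyRes (tateLocalRep W p (Sum.inr ((primesEquiv (R := 𝓞 ℚ)).symm ⟨p, hp.out⟩))) (absGaloisRestrict (((primesEquiv (R := 𝓞 ℚ)).symm ⟨p, hp.out⟩).adicCompletion ℚ) (w₀.1.adicCompletion (CyclotomicField m ℚ))) 1 h) =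
        algebraMap (((primesEquiv (R := 𝓞 ℚ)).symm ⟨p, hp.out⟩).adicCompletion ℚ) (w₀.1.adicCompletion (CyclotomicField m ℚ)) (expStarOmegaAt d h)) →
      ∀ (σ : ((primesEquiv (R := 𝓞 ℚ)).symm ⟨p, hp.out⟩).Extension (𝓞 (CyclotomicField m ℚ)) →
          (CyclotomicField m ℚ ≃ₐ[ℚ] CyclotomicField m ℚ))
        (hσ : ∀ w : ((primesEquiv (R := 𝓞 ℚ)).symm ⟨p, hp.out⟩).Extension (𝓞 (CyclotomicField m ℚ)), σ w • w.1 = w₀.1)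
        (t : Π w : ((primesEquiv (R := 𝓞 ℚ)).symm ⟨p, hp.out⟩).Extension (𝓞 (CyclotomicField m ℚ)),
          w.1.adicCompletion (CyclotomicField m ℚ)),
        (∀ w, ∃ z, t w = galAdicCompletionMap (σ w)⁻¹ (inv_smul_eq_of_smul_eq (hσ w))
          (expStarOmegaHom (LocalField.valuation_adicCompletion_natCast_lt_one w₀.1 p (Kw.prime_mem_asIdeal w₀)) ((galRestrictPlace ((primesEquiv (R := 𝓞 ℚ)).symm ⟨p, hp.out⟩)).comp (absGaloisRestrict (((primesEquiv (R := 𝓞 ℚ)).symm ⟨p, hp.out⟩).adicCompletion ℚ) (w₀.1.adicCompletion (CyclotomicField m ℚ)))) dw hinjw hexw z)) →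
        ∀ w, t w ∈ w.1.adicCompletionIntegers (CyclotomicField m ℚ) := by
  intro dw hinjw hexw hres σ hσ t ht w
  obtain ⟨z, hz⟩ := ht w
  exact mem_adicCompletionIntegers_of_eq_galAdicCompletionMap (σ w) (hσ w) _
    (expStarOmegaHom_mem_adicCompletionIntegers_of_katoClause p hT₂ W hp5 hadd d hinj hex hdual m hpm hcl w₀ dw hinjw
      hexw hres z) (t w) hz

end Summit.BirchSwinnertonDyer.BirchSwinnertonDyer.Theorems.SemiLocalIntegrality

end
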